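import Summits.AtomisticToContinuum.Crystallization.Theorems.ExcessDecayLiouvilleChainStep

/-!
# Route `ExcessDecayLiouville`: running the chain (nonlinear half, XLI)

Harmonic-replacement architecture for item `ExcessDecay` (stmt-AtomisticToContinuum-9334), nonlinear half.
* `chain_run` — `n` scales of the chain: `ChainInv` at `(σ, γ)` gives `ChainInv` at `(σ/(4L¹⁰)ⁿ, L¹⁰ⁿγ)` as long as
  `σ/(4L¹⁰)ⁿ ≥ L¹⁷` (induction on `n` over `chain_step`);
* `mass_centre_le` — the local mass about `x` at radius `X` is at most the local mass about `c` at radius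
  `X + dist x c` (centre switch);
* `chainInv_init` — the initial invariant at a site `x` of `B_{σ₀²}(c)` from the masses about `c` of a relaxed
  affine-plus-shift approximant (budgets `U = Vb = 0`);
* `sq_sum_ge` — bookkeeping under one square.
All `[folklore]`; helper lemmas, nothing here closes an item.
-/

noncomputable section

namespace Summit.AtomisticToContinuum.Crystallization.Theorems.ExcessDecayLiouville

open scoped BigOperators Topology InnerProductSpace RealInnerProductSpace Classical
open Literature.MathematicalPhysics.StatisticalMechanics
open Summit.AtomisticToContinuum.Crystallization.Theorems.PhononStabilityNegative

local notation "E3" => EuclideanSpace ℝ (Fin 3)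

-- Local notation: the force-constant map `K(e)w = h(|e|²)w + 2⟪e,w⟫h′(|e|²)e`.
local notation3 "𝕂[" e "] " w:max =>
  (-((‖e‖ ^ 2)⁻¹) ^ 7 + ((‖e‖ ^ 2)⁻¹) ^ 4) • w + (2 * ⟪e, w⟫ * (7 * ((‖e‖ ^ 2)⁻¹) ^ 8 - 4 * ((‖e‖ ^ 2)⁻¹) ^ 5)) • e
-- Local notation: the pair force `F(x) = h(|x|²) x`.
local notation3 "𝐅[" x "]" => ((-((‖x‖ ^ 2)⁻¹) ^ 7 + ((‖x‖ ^ 2)⁻¹) ^ 4) • x)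
set_option quotPrecheck false in
-- Local notation: ball indicator.
local notation "𝟙ᵇ[" x ", " c ", " R "]" => (if dist (x : EuclideanSpace ℝ (Fin 3)) c ≤ R then (1 : ℝ) else 0)

section

variable {X : Set E3} {c : E3} {r ε δ κ : ℝ} {t : Fin 2 → E3} {A : E3 →L[ℝ] E3} {π : E3 → E3}
  {aff₀ aff : E3 → E3} {a : Fin 2 → E3} {B : E3 →L[ℝ] E3} {c₀ : E3}

variable (hA : Adm₀ A) (hI : Inner₀ t A)

set_option quotPrecheck false in
-- Local notation: the operator row `(L v)(p)`.
local notation "𝕃" v:max " @ " p:max =>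
  tsum (fun q : Sites₀ t A => (if ((p : Sites₀ t A) : E3) ≠ q then 𝕂[((p : Sites₀ t A) : E3) - q] (v ((p : Sites₀ t A) : E3) - v q) else 0))
set_option quotPrecheck false in
-- Local notation: the finite near-neighbour form on the ball of radius `X` about `c₀`.
local notation "NN[" v ", " X "]" =>
  (∑ p ∈ (finite_sites_dist_le (t := t) (A := A) hA hI c₀ X).toFinset,
    ∑ q ∈ (finite_sites_dist_le (t := t) (A := A) hA hI c₀ X).toFinset,
      (if p ≠ q ∧ dist p q ≤ 11 / 10 then ‖v p - v q‖ ^ 2 else (0 : ℝ)))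
set_option quotPrecheck false in
-- local mass on the ball of radius `X` about `c₀`
local notation "𝐌[" f ", " X "]" =>
  tsum (fun p : Sites₀ t A => ‖f (p : E3)‖ ^ 2 * 𝟙ᵇ[p, c₀, X])
set_option quotPrecheck false in
-- Local notation: the displaced self-force `G(p)` of the background `aff`.
local notation "𝐆[" aff "] " p:max =>
  tsum (fun q : Sites₀ t A => (if (p : E3) ≠ q then 𝐅[((p : E3) - q) + (aff (p : E3) - aff q)] else 0))
set_option quotPrecheck false in
-- Local notation: the radial site cut-off `= 1` on the sites of `B_{r₁}(c)`, `0` beyond `r₁ + w`, slope `1/w`.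
local notation "𝛘[" r₁ ", " w "]" =>
  (fun x : EuclideanSpace ℝ (Fin 3) => (if x ∈ Sites₀ t A then max (min 1 ((r₁ + w - dist x c) / w)) 0 else 0))

include hA hI in
/-- **Centre switch for the local mass**: `𝐌_x[f, X] ≤ 𝐌_c[f, X + dist x c]`. [folklore] -/
theorem mass_centre_le (f : E3 → E3) (x cc : E3) (Xr : ℝ) :
    (∑' p : Sites₀ t A, ‖f (p : E3)‖ ^ 2 * 𝟙ᵇ[p, x, Xr]) ≤
      ∑' p : Sites₀ t A, ‖f (p : E3)‖ ^ 2 * 𝟙ᵇ[p, cc, Xr + dist x cc] := by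
  refine (summable_normSq_indicator hA hI f x Xr).tsum_le_tsum (fun p => ?_) (summable_normSq_indicator hA hI f cc (Xr + dist x cc))
  have h0 : 0 ≤ ‖f p‖ ^ 2 := sq_nonneg _
  by_cases hx : dist (p : E3) x ≤ Xr
  · have : dist (p : E3) cc ≤ Xr + dist x cc := by have := dist_triangle (p : E3) x cc; linarith
    rw [if_pos hx, if_pos this]
  · rw [if_neg hx, mul_zero]; split_ifs <;> positivity

include hA hI in
/-- **The initial invariant at a site of `B_{σ₀²}(c)`** (centre switch; budgets `U = Vb = 0`). [folklore] -/
theorem chainInv_init (hr : 0 < r) {aff₀ : E3 → E3} {a₀ : Fin 2 → E3} {B₀ : E3 →L[ℝ] E3}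
    (haff₀ : ∀ (m : Fin 2) (z : E3), z ∈ Λ₀ → aff₀ (t m + A z) = a₀ m + B₀ (t m + A z - c))
    (hrel₀ : ∀ p : Sites₀ t A, 𝐆[aff₀] p = 0)
    {C₁ σ₀ : ℝ} (hC₁ : 0 ≤ C₁)
    (hmass₀ : ∀ Y : ℝ, 1 ≤ Y → σ₀ ^ 2 ≤ Y → Y ≤ r / 2 →
      (∑' p : Sites₀ t A, ‖(fun x : E3 => 𝛘[r / 2, r / 4] x • ((π x - x) - aff₀ x)) (p : E3)‖ ^ 2 * 𝟙ᵇ[p, c, Y]) ≤ 32 * C₁ * Y ^ 6)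
    {x : E3} (hxd : dist x c ≤ σ₀ ^ 2) (hσ₀r : σ₀ ^ 2 ≤ r / 4)
    {L Φ ν Du Ustar Vstar b₀ j₀ γ₀ : ℝ} (hL17 : L ^ 17 ≤ σ₀) (hγC : 64 * C₁ ≤ γ₀ ^ 2)
    (hb₀ : ‖B₀‖ ≤ b₀) (hj₀ : ‖a₀ 0 - a₀ 1‖ ≤ j₀) (hDu : 0 ≤ Du) (hLpos : 0 < L)
    (hU : 2 * (γ₀ * σ₀) + 2 * (σ₀ ^ 2 * (Φ + ν)) ≤ Ustar) (hV : 2 * vAgg σ₀ γ₀ Φ Du r ≤ Vstar) :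
    ChainInv t A π c r x aff₀ L Φ ν Du Ustar Vstar b₀ j₀ σ₀ γ₀ σ₀ γ₀ 0 0 aff₀
      (fun m => a₀ m + B₀ (x - c)) B₀ := by
  have hσ₀0 : 0 < σ₀ := lt_of_lt_of_le (by positivity) hL17
  unfold ChainInv
  have hb' : ‖B₀‖ ≤ b₀ + 12 * L ^ 8 * 0 := by rw [mul_zero, add_zero]; exact hb₀
  have hj' : ‖(fun m => a₀ m + B₀ (x - c)) 0 - (fun m => a₀ m + B₀ (x - c)) 1‖ ≤ j₀ + 2 * L ^ 13 * 0 := by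
    rw [mul_zero, add_zero, add_sub_add_right_eq_sub]; exact hj₀
  refine ⟨?_, hrel₀, ?_, hb', hj', ?_, le_rfl, le_rfl, ?_, by linarith, hL17, le_rfl, le_rfl⟩
  · intro m z hz
    rw [haff₀ m z hz]; simp only [map_sub, map_add]; abel
  · intro Xr h1 hlo hhi
    have h := mass_centre_le hA hI (fun x : E3 => 𝛘[r / 2, r / 4] x • ((π x - x) - aff₀ x)) x c Xr
    have hdxc : 0 ≤ dist x c := dist_nonneg
    refine h.trans ((hmass₀ (Xr + dist x c) (by linarith) (by linarith) (by linarith)).trans ?_)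
    have hXd : Xr + dist x c ≤ 2 * Xr := by linarith
    have h6 : (Xr + dist x c) ^ 6 ≤ (2 * Xr) ^ 6 := pow_le_pow_left₀ (by linarith [dist_nonneg (x := x) (y := c)]) hXd 6
    have hX0 : 0 ≤ Xr ^ 6 := by positivity
    calc 32 * C₁ * (Xr + dist x c) ^ 6 ≤ 32 * C₁ * (2 * Xr) ^ 6 := mul_le_mul_of_nonneg_left h6 (by positivity)
      _ = 32 * (64 * C₁) * Xr ^ 6 := by ring
      _ ≤ 32 * γ₀ ^ 2 * Xr ^ 6 := by nlinarith [hγC, hX0]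
  · intro y _; simp
  · have : 0 ≤ 2 * (1 / (4 * L ^ 10)) * (Du / (σ₀ * r ^ 2)) := by positivity
    linarith

include hA hI in
/-- **Running the chain for `n` scales** (induction over `chain_step`). [folklore] -/
theorem chain_run (hκ0 : 0 < κ) (hκ1 : κ ≤ 1)
    (hκ : ∀ v : E3 → E3, (Function.support v).Finite →
      Function.support v ⊆ Sites₀ t A → κ * nnForm t A v ≤ ∑' p : Sites₀ t A, ⟪𝕃 v @ p, v p⟫)
    (hX : X.Finite) (hsep : Sep₀ X δ) (hequil : Equil₀ X) (hδ : 0 < δ) (hδ1 : δ ≤ 1)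
    (hε0 : 0 ≤ ε) (hε : 2 * ε < δ) (hr : 192 ≤ r)
    (hXb : ∀ p ∈ X, dist p c ≤ r → ∃ m : Fin 2, ∃ z ∈ Λ₀, dist p (t m + A z) ≤ ε)
    (hπ : ∀ s' ∈ Sites₀ t A, dist s' c ≤ r → π s' ∈ X ∧ dist (π s') s' ≤ ε)
    (hinj : ∀ s₁ ∈ Sites₀ t A, ∀ s₂ ∈ Sites₀ t A, dist s₁ c ≤ r → dist s₂ c ≤ r → π s₁ = π s₂ → s₁ = s₂)
    (SR : Finset E3) (hSR : ∀ x, x ∈ SR ↔ x ∈ Sites₀ t A ∧ dist x c ≤ r) (hc₀ : dist c₀ c ≤ r / 8)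
    {Du ν Λs σ₀ γ₀ Ustar Vstar b₀ j₀ Du₀ : ℝ} (hDu0 : 0 ≤ Du) (hDu1 : Du ≤ 1 / 20) (hν : 0 ≤ ν) (hγ₀ : 0 ≤ γ₀)
    {ja jb : ℝ} (hN : ntotGen κ r δ ε Du ja jb ≤ ν ^ 2 * r ^ 7)
    (Cja : j₀ + 2 * lcOf κ ^ 13 * (Ustar + Du / r ^ 2) ≤ ja) (hja : ja ≤ 1 / 100)
    (Cjb : b₀ + 12 * lcOf κ ^ 8 * (Ustar + Du / r ^ 2) ≤ jb)
    (CΛ : 4000000 * (210000 * ((25 / 23) * (2 * Du + ja) + jb)) ≤ κ / 12)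
    (hσ₀r : 737600 * σ₀ ^ 2 + 153600 ≤ r)
    (hDu₀ : ∀ x ∈ SR, ‖(π x - x) - aff₀ x‖ ≤ Du₀)
    (C1 : lcOf κ ^ 13 * (Ustar / 2 + Du / (4 * r ^ 2)) ≤ κ ^ 2 / 10 ^ 11)
    (C2a : j₀ + 2 * lcOf κ ^ 13 * (Ustar + Du / r ^ 2) ≤ κ / (2 * 10 ^ 10))
    (C2b : b₀ + 12 * lcOf κ ^ 8 * (Ustar + Du / r ^ 2) ≤ κ / (2 * 10 ^ 10))
    (C2c : 2 * r * (b₀ + 12 * lcOf κ ^ 8 * (Ustar + Du / r ^ 2)) ≤ 1 / 100)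
    (C3 : Du₀ + lcOf κ ^ 8 * Vstar +
      (lcOf κ ^ 13 + 14 * lcOf κ ^ 8 + 12 * lcOf κ ^ 8 * (5 * r / 4 + 11 / 10)) * (Ustar + Du / r ^ 2) ≤ Du)
    (C4a : 4000000 * lamOf Du (j₀ + 2 * lcOf κ ^ 13 * (Ustar + Du / r ^ 2)) (b₀ + 12 * lcOf κ ^ 8 * (Ustar + Du / r ^ 2)) ≤ κ / 16)
    (C4b : lamOf Du (j₀ + 2 * lcOf κ ^ 13 * (Ustar + Du / r ^ 2)) (b₀ + 12 * lcOf κ ^ 8 * (Ustar + Du / r ^ 2)) ≤ Λs)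
    (C4c : lcOf κ ^ 113 * Λs ^ 2 ≤ 1)
    (C5 : lcOf κ ^ 114 * floorAgg σ₀ (phiOf Du r δ) ν Du r ≤ γ₀ ^ 2) (n : ℕ) :
    ∀ {σ γ U Vb : ℝ} {aff : E3 → E3} {a : Fin 2 → E3} {B : E3 →L[ℝ] E3},
      ChainInv t A π c r c₀ aff₀ (lcOf κ) (phiOf Du r δ) ν Du Ustar Vstar b₀ j₀ σ₀ γ₀ σ γ U Vb aff a B →
      lcOf κ ^ 17 ≤ σ / (4 * lcOf κ ^ 10) ^ n →
      ∃ (U' Vb' : ℝ) (aff' : E3 → E3) (a' : Fin 2 → E3) (B' : E3 →L[ℝ] E3),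
        ChainInv t A π c r c₀ aff₀ (lcOf κ) (phiOf Du r δ) ν Du Ustar Vstar b₀ j₀ σ₀ γ₀
          (σ / (4 * lcOf κ ^ 10) ^ n) ((lcOf κ ^ 10) ^ n * γ) U' Vb' aff' a' B' := by
  obtain ⟨hL, -, -⟩ := lcOf_ge hκ0 hκ1
  have hL0 : 0 < lcOf κ := lt_of_lt_of_le (by norm_num) hL
  induction n with
  | zero =>
    intro σ γ U Vb aff a B hinv _
    refine ⟨U, Vb, aff, a, B, ?_⟩
    simpa using hinv
  | succ n ih =>
    intro σ γ U Vb aff a B hinv hnext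
    have hq : 0 < (4 * lcOf κ ^ 10) := by positivity
    -- the first n scales
    have hnext' : lcOf κ ^ 17 ≤ σ / (4 * lcOf κ ^ 10) ^ n := by
      refine hnext.trans ?_
      obtain ⟨-, -, -, -, -, -, -, -, -, -, hσm, -, -⟩ := hinv
      have hσ0 : 0 ≤ σ := le_trans (by positivity) hσm
      refine div_le_div_of_nonneg_left hσ0 (by positivity) ?_
      rw [pow_succ]
      exact le_mul_of_one_le_right (by positivity) (by nlinarith [one_le_pow₀ (M₀ := ℝ) (n := 10) (le_trans (by norm_num) hL)])
    obtain ⟨U₁, Vb₁, aff₁, a₁, B₁, hinv₁⟩ := ih hinv hnext'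
    -- the last scale
    have hnext₁ : lcOf κ ^ 17 ≤ σ / (4 * lcOf κ ^ 10) ^ n / (4 * lcOf κ ^ 10) := by
      rw [div_div, ← pow_succ]; exact hnext
    obtain ⟨aff', a', B', hinv'⟩ := chain_step hA hI hκ0 hκ1 hκ hX hsep hequil hδ hδ1 hε0 hε hr hXb hπ hinj SR hSR hc₀ hDu0 hDu1 hν hγ₀ hN
      Cja hja Cjb CΛ hσ₀r hDu₀ C1 C2a C2b C2c C3 C4a C4b C4c C5 hinv₁ hnext₁
    have e1 : σ / (4 * lcOf κ ^ 10) ^ n / (4 * lcOf κ ^ 10) = σ / (4 * lcOf κ ^ 10) ^ (n + 1) := by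
      rw [div_div, ← pow_succ]
    have e2 : lcOf κ ^ 10 * ((lcOf κ ^ 10) ^ n * γ) = (lcOf κ ^ 10) ^ (n + 1) * γ := by ring
    rw [e1, e2] at hinv'
    exact ⟨_, _, aff', a', B', hinv'⟩

/-- Bookkeeping: four nonnegative terms, one of them dominated, under one square. [folklore] -/
theorem sq_sum_ge {a b c d x : ℝ} (ha : 0 ≤ a) (hb : 0 ≤ b) (hc : 0 ≤ c) (hd : 0 ≤ d) (hx : x ≤ b ^ 2) :
    a ^ 2 + x + c ^ 2 + d ^ 2 ≤ (a + b + c + d) ^ 2 := by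
  nlinarith [mul_nonneg ha hb, mul_nonneg ha hc, mul_nonneg ha hd, mul_nonneg hb hc, mul_nonneg hb hd, mul_nonneg hc hd]

end

end Summit.AtomisticToContinuum.Crystallization.Theorems.ExcessDecayLiouville

end
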